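import Literature.NumberTheory.GaloisRepresentations.RelativeCorestrictionConj
import Literature.NumberTheory.GaloisRepresentations.CorNaturality
import HarnessLib

/-!
# The relative corestriction along nested closed subgroups is NATURAL in the coefficient module, all degrees:
# `cor_{V/V'} ∘ H^q(f|V') = H^q(f|V) ∘ cor_{V/V'}` on `H^q(V', M) → H^q(V, M')`

Topic `NumberTheory/GaloisRepresentations`; namespace `Literature.NumberTheory.GaloisRepresentations`. THEOREMS
ONLY (no definition, no named fact, no instance, no `sorry`). Companion of `RelativeCorestrictionConj.lean`
(equivariance of `relCor` for the ambient conjugation) and of `CorNaturality.lean` (naturality of `cor` in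
POSITIVE degrees, via `ext ∘ sh = id`); here naturality holds in EVERY degree `q ≥ 0`, through the Shapiro
ISOMORPHISM (`shapiro_map_injective/surjective`, degree `0` included) exactly as `cor_conjMapSubOf` is proved.

SETTING. `Γ` profinite, `V' ≤ V ≤ Γ` closed subgroups with `[V : V']` finite, `f : M → M'` a morphism of
discrete `Γ`-modules (`ρ`, `ω`). STATEMENTS (Neukirch–Schmidt–Wingberg I §5 Prop. 1.5.2: `cor` is a morphism
of δ-functors, in particular natural; Serre I §2.5):
* `cor_cohomologyMapSubOf` — `cor_{V/V'} (H^q(f|) z) = H^q(f|V) (cor_{V/V'} z)` on `H^q(V'.subgroupOf V, M)`;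
* `toSubgroupOf_cohomologyMap` — the tautological comparison `H^q(V', M) → H^q(V'.subgroupOf V, M)` is natural;
* `relCor_cohomologyMap` — **`relCor (H^q(f|V') z) = H^q(f|V) (relCor z)`**, every `q`: the transition maps of
  the inverse systems `(H^q(V_n, M))_n` of Iwasawa theory are natural in `M` — so the compatible families
  `lim←_n H^q(V_n, M)` are functorial in the coefficients (used for the COEFFICIENT-RING action
  `c ↦ H^q(c ⊗ id)` on `lim←_{n,k} H^q(G_S(K̃_n), 𝒪 ⊗ μ_{p^k} ⊗ θ)`, `EllipticUnits.JohnsonLeungKings2011.IwasawaCohomologyDataO`).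
Filed by the INPUTS hand `bsd-inputs-honda-p1` (g22), crux L `SmallImageLowerHalfBothSigns` line `rtt_w3` (D2-O-exist).

## References
* [NeukirchSchmidtWingberg2008] I §5 Prop. 1.5.2–1.5.4 (cor natural, transitive, commutes with conjugation).
* [SerreGaloisCohomology1997] I §2.5 (induced modules, Shapiro, corestriction).
-/

noncomputable section

open CategoryTheory Function

universe u

namespace Literature.NumberTheory.GaloisRepresentations

open _root_.TopRep _root_.ContRepresentation _root_.ContinuousCohomology

section RelCorNat

variable {Γ : Type u} [Group Γ] [TopologicalSpace Γ] [IsTopologicalGroup Γ] [CompactSpace Γ]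
  [T2Space Γ] [TotallyDisconnectedSpace Γ]
variable (V V' : Subgroup Γ) [hV : IsClosed (V : Set Γ)] [hV' : IsClosed (V' : Set Γ)]
variable {M M' : Type u} [AddCommGroup M] [TopologicalSpace M] [DiscreteTopology M]
  [AddCommGroup M'] [TopologicalSpace M'] [DiscreteTopology M']
variable (ρ : ContinuousRep Γ ℤ M) (ω : ContinuousRep Γ ℤ M') (f : ρ.toTopRep ⟶ ω.toTopRep)

attribute [local instance] compactSpace_of_isClosed_subgroup discreteTopology_coind
  isClosed_subgroupOf_of_isClosed

variable [Fintype (V ⧸ V'.subgroupOf V)]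

/-- **`cor_{V/V'}` on `H^q(V'.subgroupOf V, ·)` is natural in the coefficients, EVERY degree `q`**:
`cor (H^q(f|) z) = H^q(f|V) (cor z)` — through the Shapiro isomorphism `sh` (`cor = H(N) ∘ sh⁻¹`, `sh` natural in
`V'.subgroupOf V`-morphisms, `N ∘ M_V^{V'}(f) = f ∘ N`). [cite: NeukirchSchmidtWingberg2008, I §5 Prop. 1.5.2] [cite: SerreGaloisCohomology1997, I §2.5] -/
theorem cor_cohomologyMapSubOf (q : ℕ) (z : continuousCohomology q (repSub V V' ρ).toTopRep) :
    cor (V'.subgroupOf V) (ω.restrict (subgroupIncl V)) q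
        (cohomologyMap (resModHom (V'.subgroupOf V) (resModHom V f)) q z) =
      cohomologyMap (resModHom V f) q (cor (V'.subgroupOf V) (ρ.restrict (subgroupIncl V)) q z) := by
  obtain ⟨y, hy⟩ := shapiro_map_surjective (repSub V V' ρ) q z
  have hy' : shMap (V'.subgroupOf V) (ρ.restrict (subgroupIncl V)) q y = z := hy
  -- `sh⁻¹ (H(f|) z) = H(M(f|)) (sh⁻¹ z)`
  have h1 : extMap (V'.subgroupOf V) (ω.restrict (subgroupIncl V)) q
        (cohomologyMap (resModHom (V'.subgroupOf V) (resModHom V f)) q z) =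
      cohomologyMap (coindMapHom (V'.subgroupOf V) (resModHom (V'.subgroupOf V) (resModHom V f))) q y := by
    apply shapiro_map_injective (repSub V V' ω) q
    change shMap (V'.subgroupOf V) (ω.restrict (subgroupIncl V)) q
        (extMap (V'.subgroupOf V) (ω.restrict (subgroupIncl V)) q _) =
      shMap (V'.subgroupOf V) (ω.restrict (subgroupIncl V)) q _
    rw [sh_extMap, ← cohomologyMap_shMap, hy']
  have h2 : extMap (V'.subgroupOf V) (ρ.restrict (subgroupIncl V)) q z = y := by
    apply shapiro_map_injective (repSub V V' ρ) q
    change shMap (V'.subgroupOf V) (ρ.restrict (subgroupIncl V)) q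
        (extMap (V'.subgroupOf V) (ρ.restrict (subgroupIncl V)) q z) =
      shMap (V'.subgroupOf V) (ρ.restrict (subgroupIncl V)) q y
    rw [sh_extMap, hy']
  -- `H(N) ∘ H(M(f|)) = H(f|V) ∘ H(N)`
  have hNf : coindMapHom (V'.subgroupOf V) (resModHom (V'.subgroupOf V) (resModHom V f)) ≫
        normCoind (ω.restrict (subgroupIncl V)) =
      normCoind (ρ.restrict (subgroupIncl V)) ≫ resModHom V f := by
    ext F
    exact normCoind_coindMapHom (V'.subgroupOf V) (resModHom V f) F
  rw [cor_apply, cor_apply, h1, h2, ← cohomologyMap_comp_apply, hNf, cohomologyMap_comp_apply]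

omit [CompactSpace Γ] [T2Space Γ] [TotallyDisconnectedSpace Γ] hV hV' [Fintype (V ⧸ V'.subgroupOf V)] in
/-- **The tautological comparison `H^q(V', M) → H^q(V'.subgroupOf V, M)` is natural in the coefficients**
(both composites are the map of the pair `(V'.subgroupOf V ≅ V', f)`). [cite: SerreGaloisCohomology1997, I §2.5] -/
theorem toSubgroupOf_cohomologyMap (h : V' ≤ V) (q : ℕ)
    (z : continuousCohomology q (ρ.restrict (subgroupIncl V')).toTopRep) :
    toSubgroupOf ω.toTopRep h q (cohomologyMap (resModHom V' f) q z) =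
      cohomologyMap (resModHom (V'.subgroupOf V) (resModHom V f)) q (toSubgroupOf ρ.toTopRep h q z) := by
  let F : TopRep.res ((subgroupOfHom h : (V'.subgroupOf V : Subgroup V) →ₜ* V') :
        (V'.subgroupOf V : Subgroup V) →* V') (ρ.restrict (subgroupIncl V')).toTopRep ⟶ (repSub V V' ω).toTopRep :=
    TopRep.ofHom ⟨f.hom.toContinuousLinearMap, fun s ↦ f.hom.isIntertwining' ((subgroupOfHom h s : V') : Γ)⟩
  have h1 : toSubgroupOf ω.toTopRep h q (cohomologyMap (resModHom V' f) q z) =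
      ContinuousCohomology.map (subgroupOfHom h) F q z :=
    (map_comp_apply_of (X := (ρ.restrict (subgroupIncl V')).toTopRep) (Y := (ω.restrict (subgroupIncl V')).toTopRep)
      (Z := (repSub V V' ω).toTopRep) (ContinuousMonoidHom.id V') (subgroupOfHom h) (subgroupOfHom h)
      (fun _ ↦ rfl) (resIdHom (resModHom V' f))
      (TopRep.ofHom ⟨ContinuousLinearMap.id ℤ M', fun _ ↦ rfl⟩) F (fun _ ↦ rfl) q z).symm
  have h2 : cohomologyMap (resModHom (V'.subgroupOf V) (resModHom V f)) q (toSubgroupOf ρ.toTopRep h q z) =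
      ContinuousCohomology.map (subgroupOfHom h) F q z :=
    (map_comp_apply_of (X := (ρ.restrict (subgroupIncl V')).toTopRep) (Y := (repSub V V' ρ).toTopRep)
      (Z := (repSub V V' ω).toTopRep) (subgroupOfHom h) (ContinuousMonoidHom.id _) (subgroupOfHom h)
      (fun _ ↦ rfl) (TopRep.ofHom ⟨ContinuousLinearMap.id ℤ M, fun _ ↦ rfl⟩)
      (resIdHom (resModHom (V'.subgroupOf V) (resModHom V f))) F (fun _ ↦ rfl) q z).symm
  rw [h1, h2]

/-- **MAIN STATEMENT — `relCor (H^q(f|V') z) = H^q(f|V) (relCor z)`**: the relative corestriction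
`H^q(V', M) → H^q(V, M)` along closed subgroups `V' ≤ V` of a profinite group, `[V : V']` finite, is natural in
morphisms of discrete `Γ`-modules, in every degree `q` — the compatible families `(y_n)_n`, `cor y_{n+1} = y_n`,
along a tower are functorial in the coefficients (so that a coefficient RING acting on `M` by `Γ`-endomorphisms
acts on `lim←_n H^q(V_n, M)`). [cite: NeukirchSchmidtWingberg2008, I §5 Prop. 1.5.2] [cite: SerreGaloisCohomology1997, I §2.5] -/
theorem relCor_cohomologyMap (h : V' ≤ V) (q : ℕ) (z : continuousCohomology q (ρ.restrict (subgroupIncl V')).toTopRep) :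
    relCor V V' ω h q (cohomologyMap (resModHom V' f) q z) =
      cohomologyMap (resModHom V f) q (relCor V V' ρ h q z) := by
  rw [relCor_apply, relCor_apply, toSubgroupOf_cohomologyMap, cor_cohomologyMapSubOf]

end RelCorNat

/-! ### Appendix: the absolute corestriction `cor : H^q(S, M) → H^q(G, M)` is natural in ALL degrees -/

section CorAllDegrees

variable {G : Type u} [Group G] [TopologicalSpace G] [IsTopologicalGroup G] [CompactSpace G]
  [T2Space G] [TotallyDisconnectedSpace G]
variable (S : Subgroup G) [hS : IsClosed (S : Set G)] [Fintype (G ⧸ S)]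
variable {M M' : Type u} [AddCommGroup M] [TopologicalSpace M] [DiscreteTopology M]
  [AddCommGroup M'] [TopologicalSpace M'] [DiscreteTopology M']
variable (ρ : ContinuousRep G ℤ M) (ω : ContinuousRep G ℤ M')

attribute [local instance] compactSpace_of_isClosed_subgroup discreteTopology_coind

/-- **Naturality of the corestriction `cor : H^q(S, M) → H^q(G, M)` in morphisms of discrete `G`-modules, EVERY degree
`q ≥ 0`** (the tree's `cor_cohomologyMap` is the case `q ≥ 1`; degree `0` is included here through the all-degree Shapiro
isomorphism `shapiro_map_injective/surjective`, as suggested in the review of this file): `cor (H^q(f|_S) z) = H^q(f) (cor z)`.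
[cite: NeukirchSchmidtWingberg2008, I §5 Prop. 1.5.2] [cite: SerreGaloisCohomology1997, I §2.5] -/
theorem cor_cohomologyMap_all (f : ρ.toTopRep ⟶ ω.toTopRep) (q : ℕ)
    (z : continuousCohomology q (ρ.restrict (subgroupIncl S)).toTopRep) :
    cor S ω q (cohomologyMap (resModHom S f) q z) = cohomologyMap f q (cor S ρ q z) := by
  obtain ⟨y, hy⟩ := shapiro_map_surjective (ρ.restrict (subgroupIncl S)) q z
  have hy' : shMap S ρ q y = z := hy
  have h1 : extMap S ω q (cohomologyMap (resModHom S f) q z) = cohomologyMap (coindMapHom S (resModHom S f)) q y := by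
    apply shapiro_map_injective (ω.restrict (subgroupIncl S)) q
    change shMap S ω q (extMap S ω q _) = shMap S ω q _
    rw [sh_extMap, ← cohomologyMap_shMap, hy']
  have h2 : extMap S ρ q z = y := by
    apply shapiro_map_injective (ρ.restrict (subgroupIncl S)) q
    change shMap S ρ q (extMap S ρ q z) = shMap S ρ q y
    rw [sh_extMap, hy']
  have hNf : coindMapHom S (resModHom S f) ≫ normCoind ω = normCoind ρ ≫ f := by
    ext F
    exact normCoind_coindMapHom S f F
  rw [cor_apply, cor_apply, h1, h2, ← cohomologyMap_comp_apply, hNf, cohomologyMap_comp_apply]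

end CorAllDegrees

end Literature.NumberTheory.GaloisRepresentations

end
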